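/-
Copyright (c) 2026 the pub-hodgecm-mathlib formalisation cell (harness21).  Prover seat hodgecm-mathlib-LH4-p10 (g9) (valve hand), Track B «K2-LIT»,
#184♮ = hLiu418 = `stmt-HodgeConjecture-24832`; socket #41, KIND W, organ «Φ6b-ind» (R3)-G6 HEAD (KW desk F0P2-p08 (g4) DEAL 2026-09-05T01:45:10Z; organ architect
K2E4-p11 (g9) (R3) census 01:29:58Z (1); G5 producer K2E4-p10 (g10)).  The indefinite twin of ★ LH4-p08 `K2LiuKindWArchWhittakerGrowthAtOnePic` §2, HYPOTHESIS-FIRST on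
`hJetGrowth`.  THEOREMS ONLY (no `def`, no `instance`, no notation, no named-fact hypothesis, no `sorry`).
-/
import Summits.HodgeConjecture.HodgeConjecture.Theorems.K2LiuKindWArchWhittakerGrowthIndefExplicit   -- (R3)-G6 FILE 1 (this seat): the engine (+ ★ 2b′, ★ IndefiniteLetter, ★ conversions)
import Summits.HodgeConjecture.HodgeConjecture.Theorems.K2LiuKindWArchIndefiniteLetterPic          -- (R3)-G6 FILE 0 (this seat): ★ p864067 at a generic picture (the non-Siegel-form branch)
import HarnessLib

/-!
# Crux `HLiu418`, socket #41, KIND W — (R3)-G6 HEAD `K2LiuKindWArchWhittakerGrowthIndef`: GROWTH OF THE CONTINUED PER-PLACE WHITTAKER LETTERS AT AN INDEFINITE FRAMED INDEX,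
# CONSTANTS ∃-BOUND BEFORE `∀ hidx ∀ g` (Siegel-form decompositions, `u₀ = 1`), modulo the jet-growth letter `hJetGrowth`

Cell `hodgecm-mathlib`, crux item hLiu418 = `stmt-HodgeConjecture-24832` (helper lane `--supports … --as helper`, count-neutral); squad K2, KW line.
THE FACE (architect's (1); ★ 2b′ `exists_growth_constants_of_posDef_pic`'s conclusion with `hidx.PosDef` ↦ the ONE conjunction `hidxᴴ = hidx ∧ hidx.det.re < 0` = K2E3-p11's
frozen `hAtOne` slot 01:49:04Z under `sgn hidx`):
**`exists_growth_constants_of_indef_pic (hJetGrowth) (hk : -2 ≤ k) (Pic) (hx) (hKpic)`** (generic picture predicate `Pic`; the `evalAt … Q` head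
`exists_growth_constants_of_indef_at_one` is its one-line instance, as ★ `K2LiuKindWArchWhittakerGrowthAtOne` does for ★ 2b′) ⊢ `∃ Ew : (hidx, g) ↦ Ew hidx g`, (i) holomorphic on `{0 < re}` with the twisted-integral
formula on some `{s₀ < re}` for EVERY hermitian indefinite index, twist reading and `g ∈ U(J)` (FILE 1's formula at a Siegel-form decomposition when one exists, ★
`K2LiuKindWArchIndefiniteLetterPic.exists_twistedWhittaker_continuation_of_indef_pic` (FILE 0) otherwise — its `hJet` read off `hJetGrowth`); (ii) `∀ z, 0 < re z → ∃ Cg cg N N' r` (BEFORE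
`∀ hidx ∀ g`) with `‖Ew hidx g s‖ ≤ Cg·‖det R‖^{2−2re s}·e^{−cg·T₂}·(1+T₂)^N·(1+‖det(R h₁ R)‖^{−N′})` on `dist s z < r` for every Siegel-form decomposition
`diag(C,−B)·g = n(X₀)·diag(R,R⁻¹)` (`h₁ = C⁻ᴴ·hidx·C⁻¹`, `T₂ = Σ‖(R h₁ R)_{ab}‖`).  DECOMPOSITION UNIFORMITY (the one new step w.r.t. ★ 2b′ §2): two Siegel forms differ by a
unitary `κ` (★ `levi_letters_unique`), `h₂ ↦ κᴴ h₂ κ`; `det` is invariant and, the index being INDEFINITE, the ENTRY SUM is used directly through the two-sided comparability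
`T₂(κᴴ h κ) ≤ 4·T₂(h)` (★ `entrySum_mul_mul_le`, Mathlib `entry_norm_bound_of_unitary`) — whence `cg ↦ cg∕4`, `Cg ↦ 4^N·Cg` (★ `exp_neg_mul_le_of_le_mul`, ★ `one_add_rpow_le_of_le_mul`).
[Shimura1982, §3 Thm. 3.1, §4 Thm. 4.2] [Shimura1997, §16.4, §18.4] [KudlaRallis1994, §1].
HONEST LABEL.  Count-neutral helper; (R3) stays OPEN until G4∕G5 land (`hJetGrowth` BY VALUE): `HC_CM` is proved only modulo the 7 printed citations (2 remaining named
inputs: hLiu418 = `stmt-HodgeConjecture-24832`, h413 = `stmt-HodgeConjecture-24833`) until rung 0 closes.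
-/

set_option autoImplicit false
set_option linter.dupNamespace false -- the mandated namespace repeats `HodgeConjecture.HodgeConjecture`

noncomputable section

open Complex Matrix MeasureTheory
open scoped ComplexConjugate ComplexOrder
open Literature.NumberTheory.ModularForms.SiegelUpperHalfSpace (moeb moeb_one)

namespace Summit.HodgeConjecture.HodgeConjecture.Cruxes.HLiu418.K2LiuKindWArchWhittakerGrowthIndef

open Summit.HodgeConjecture.HodgeConjecture.Cruxes.HLiu418.K2LiuHermTwoConfluentXiDefs (xiTwo)
open Summit.HodgeConjecture.HodgeConjecture.Cruxes.HLiu418.K2LiuArchInducedTubeDefs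
open Summit.HodgeConjecture.HodgeConjecture.Cruxes.HLiu418.K2LiuU22CompactPictureDefs
open Summit.HodgeConjecture.HodgeConjecture.Cruxes.HLiu418.K2LiuArchBlockOfFrame (antidiag_letters)
open Summit.HodgeConjecture.HodgeConjecture.Cruxes.HLiu418.K2LiuKindWArchWhittakerGrowth (norm_cexp_trace_mul_of_isHermitian norm_archChar_eq_one levi_letters_unique)
open Summit.HodgeConjecture.HodgeConjecture.Cruxes.HLiu418.K2LiuKindWArchIndefiniteLetter (det_re_conjTranspose_mul_mul_neg)
open Summit.HodgeConjecture.HodgeConjecture.Cruxes.HLiu418.K2LiuKindWArchIndefiniteLetterPic (exists_twistedWhittaker_continuation_of_indef_pic)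
open Summit.HodgeConjecture.HodgeConjecture.Cruxes.HLiu418.K2LiuKindWArchIwasawaComparability (entrySum_mul_mul_le)
open Summit.HodgeConjecture.HodgeConjecture.Cruxes.HLiu418.K2LiuKindWArchBlockGrowthConversion (exp_neg_mul_le_of_le_mul one_add_rpow_le_of_le_mul)
open Summit.HodgeConjecture.HodgeConjecture.Cruxes.HLiu418.K2LiuKindWArchWhittakerGrowthIndefExplicit (twistedWhittaker_indef_explicit_of_siegelForm)

/-- entries of a `2 × 2` unitary `κ` (`κ κᴴ = 1`, `κᴴ κ = 1`) and of `κᴴ` are `≤ 1`. [folklore] -/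
theorem unitary_entries_le_one {κ : Matrix (Fin 2) (Fin 2) ℂ} (hκ1 : κᴴ * κ = 1) (hκ2 : κ * κᴴ = 1) :
    (∀ i j, ‖κ i j‖ ≤ 1) ∧ ∀ i j, ‖κᴴ i j‖ ≤ 1 := by
  have hU : κ ∈ Matrix.unitaryGroup (Fin 2) ℂ := Matrix.mem_unitaryGroup_iff.2 (by simpa [Matrix.star_eq_conjTranspose] using hκ2)
  have hU' : κᴴ ∈ Matrix.unitaryGroup (Fin 2) ℂ :=
    Matrix.mem_unitaryGroup_iff.2 (by simpa [Matrix.star_eq_conjTranspose] using hκ1)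
  exact ⟨fun i j => entry_norm_bound_of_unitary hU i j, fun i j => entry_norm_bound_of_unitary hU' i j⟩

/-- **(R3)-G6 HEAD — THE FAMILY `Ew : (hidx, g) ↦ Ew hidx g` WITH GROWTH CONSTANTS ∃-BOUND BEFORE `∀ hidx ∀ g`, INDEFINITE INDEX, GENERIC PICTURE** (see the module
docstring; ★ 2b′ `exists_growth_constants_of_posDef_pic`'s twin with the sign clause `hidxᴴ = hidx ∧ hidx.det.re < 0`, HYPOTHESIS-FIRST on `hJetGrowth`).
[cite: Shimura1997, §16.4, §18.4] [cite: Shimura1982, §4 Thm. 4.2] [cite: KudlaRallis1994, §1] -/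
theorem exists_growth_constants_of_indef_pic
    (hJetGrowth : ∀ Θ : Matrix (Fin 2) (Fin 2) ℂ, Θᴴ = Θ → ∀ (e : ℕ) (a b : ℂ),
      ∃ (F : Matrix (Fin 2) (Fin 2) ℂ → ℂ → ℂ) (s₀ : ℝ),
        (∀ h : Matrix (Fin 2) (Fin 2) ℂ, hᴴ = h → h.det.re < 0 → DifferentiableOn ℂ (F h) {s : ℂ | 0 < s.re} ∧
          ∀ s : ℂ, s₀ < s.re → F h s = iteratedDeriv e (fun t : ℝ => xiTwo 1 (h + (t : ℂ) • Θ) (a + s) (b + s)) 0) ∧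
        ∀ z : ℂ, 0 < z.re → ∃ C c Np N' r : ℝ, 0 ≤ C ∧ 0 < c ∧ 0 ≤ Np ∧ 0 ≤ N' ∧ 0 < r ∧
          ∀ h : Matrix (Fin 2) (Fin 2) ℂ, hᴴ = h → h.det.re < 0 → ∀ s : ℂ, dist s z < r →
            ‖F h s‖ ≤ C * Real.exp (-(c * ∑ a, ∑ b, ‖h a b‖)) * (1 + ∑ a, ∑ b, ‖h a b‖) ^ Np * (1 + ‖h.det‖ ^ (-N')))
    {k : ℤ} (hk : -2 ≤ k) (Pic : ℂ → (Matrix (Fin 2 ⊕ Fin 2) (Fin 2 ⊕ Fin 2) ℂ → ℂ) → Prop) {B C : Matrix (Fin 2) (Fin 2) ℂ}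
    (hx : (fromBlocks 0 B C 0 : Matrix (Fin 2 ⊕ Fin 2) (Fin 2 ⊕ Fin 2) ℂ)ᴴ * Matrix.J (Fin 2) ℂ * (fromBlocks 0 B C 0 : Matrix (Fin 2 ⊕ Fin 2) (Fin 2 ⊕ Fin 2) ℂ) =
      Matrix.J (Fin 2) ℂ)
    (hKpic : ∀ k₀ : Matrix (Fin 2 ⊕ Fin 2) (Fin 2 ⊕ Fin 2) ℂ, k₀ᴴ * Matrix.J (Fin 2) ℂ * k₀ = Matrix.J (Fin 2) ℂ →
      moeb k₀ (I • (1 : Matrix (Fin 2) (Fin 2) ℂ)) = I • 1 →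
      ∃ P : MvPolynomial (((Fin 2 ⊕ Fin 2) × (Fin 2 ⊕ Fin 2)) ⊕ ((Fin 2 ⊕ Fin 2) × (Fin 2 ⊕ Fin 2))) ℂ,
        ∀ (s : ℂ) (F : Matrix (Fin 2 ⊕ Fin 2) (Fin 2 ⊕ Fin 2) ℂ → ℂ), IsArchSiegelSection (fun z : ℂ => (conj z / ((‖z‖ : ℝ) : ℂ)) ^ k) s F →
          Pic s F →
          ∀ u : Matrix (Fin 2 ⊕ Fin 2) (Fin 2 ⊕ Fin 2) ℂ, uᴴ * Matrix.J (Fin 2) ℂ * u = Matrix.J (Fin 2) ℂ → moeb u (I • (1 : Matrix (Fin 2) (Fin 2) ℂ)) = I • 1 →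
            F (u * k₀) = MvPolynomial.eval (Sum.elim (fun pq => u pq.1 pq.2) (fun pq => conj (u pq.1 pq.2))) P) :
    ∃ Ew : Matrix (Fin 2) (Fin 2) ℂ → Matrix (Fin 2 ⊕ Fin 2) (Fin 2 ⊕ Fin 2) ℂ → ℂ → ℂ,
      (∀ hidx : Matrix (Fin 2) (Fin 2) ℂ, hidxᴴ = hidx ∧ hidx.det.re < 0 →
        ∀ eb : Matrix (Fin 2) (Fin 2) ℂ → ℂ, (∀ b, eb b = cexp (-(2 * Real.pi * I) * (hidx * b).trace)) →
        ∀ g : Matrix (Fin 2 ⊕ Fin 2) (Fin 2 ⊕ Fin 2) ℂ, gᴴ * Matrix.J (Fin 2) ℂ * g = Matrix.J (Fin 2) ℂ →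
        DifferentiableOn ℂ (Ew hidx g) {s : ℂ | 0 < s.re} ∧
        ∃ s₀ : ℝ, ∀ s : ℂ, s₀ < s.re →
          ∀ F : Matrix (Fin 2 ⊕ Fin 2) (Fin 2 ⊕ Fin 2) ℂ → ℂ, IsArchSiegelSection (fun z : ℂ => (conj z / ((‖z‖ : ℝ) : ℂ)) ^ k) s F →
            Pic s F →
            ∫ r : Fin 2 → Fin 2 → ℝ, F ((fromBlocks 0 B C 0 : Matrix (Fin 2 ⊕ Fin 2) (Fin 2 ⊕ Fin 2) ℂ) * fromBlocks 1 (hermOfReal r) 0 1 * g) * eb (hermOfReal r) =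
              Ew hidx g s) ∧
      ∀ z : ℂ, 0 < z.re → ∃ Cg cg N N' r : ℝ, 0 ≤ Cg ∧ 0 < cg ∧ 0 ≤ N ∧ 0 ≤ N' ∧ 0 < r ∧
        ∀ hidx : Matrix (Fin 2) (Fin 2) ℂ, hidxᴴ = hidx ∧ hidx.det.re < 0 →
        ∀ eb : Matrix (Fin 2) (Fin 2) ℂ → ℂ, (∀ b, eb b = cexp (-(2 * Real.pi * I) * (hidx * b).trace)) →
        ∀ g : Matrix (Fin 2 ⊕ Fin 2) (Fin 2 ⊕ Fin 2) ℂ, gᴴ * Matrix.J (Fin 2) ℂ * g = Matrix.J (Fin 2) ℂ →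
          ∀ (X₀ R : Matrix (Fin 2) (Fin 2) ℂ), X₀ᴴ = X₀ → Rᴴ = R → IsUnit R.det →
            (fromBlocks C 0 0 (-B) : Matrix (Fin 2 ⊕ Fin 2) (Fin 2 ⊕ Fin 2) ℂ) * g = fromBlocks 1 X₀ 0 1 * fromBlocks R 0 0 R⁻¹ →
            ∀ s : ℂ, dist s z < r →
              ‖Ew hidx g s‖ ≤ Cg * ‖R.det‖ ^ (2 - 2 * s.re) * Real.exp (-(cg * ∑ a, ∑ b, ‖(R * ((C⁻¹)ᴴ * hidx * C⁻¹) * R) a b‖)) *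
                (1 + ∑ a, ∑ b, ‖(R * ((C⁻¹)ᴴ * hidx * C⁻¹) * R) a b‖) ^ N * (1 + ‖(R * ((C⁻¹)ᴴ * hidx * C⁻¹) * R).det‖ ^ (-N')) := by
  classical
  obtain ⟨FJ, s₀, hFJhol, hFJgr, hform⟩ := twistedWhittaker_indef_explicit_of_siegelForm hJetGrowth k Pic hx hKpic
  -- the plain jet letter for the fallback branch
  have hJet : ∀ (h Θ : Matrix (Fin 2) (Fin 2) ℂ), hᴴ = h → h.det.re < 0 → Θᴴ = Θ → ∀ (e : ℕ) (a b : ℂ),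
      ∃ (F : ℂ → ℂ) (s₀ : ℝ), DifferentiableOn ℂ F {s : ℂ | 0 < s.re} ∧
        ∀ s : ℂ, s₀ < s.re → F s = iteratedDeriv e (fun t : ℝ => xiTwo 1 (h + (t : ℂ) • Θ) (a + s) (b + s)) 0 := by
    intro h Θ hh hd hΘ e a b
    obtain ⟨F, s₁, hF, -⟩ := hJetGrowth Θ hΘ e a b
    exact ⟨F h, s₁, (hF h hh hd).1, (hF h hh hd).2⟩
  /- the frame letters -/
  obtain ⟨-, hBC⟩ := antidiag_letters hx
  have hC : C.det ≠ 0 := (Matrix.isUnit_det_of_left_inverse hBC).ne_zero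
  have hCu : IsUnit C.det := isUnit_iff_ne_zero.2 hC
  have hCiC : C⁻¹ * C = 1 := Matrix.nonsing_inv_mul C hCu
  have hCidet : (C⁻¹).det ≠ 0 := (Matrix.isUnit_det_of_right_inverse hCiC).ne_zero
  have h₁herm : ∀ hidx : Matrix (Fin 2) (Fin 2) ℂ, hidxᴴ = hidx → ((C⁻¹)ᴴ * hidx * C⁻¹)ᴴ = (C⁻¹)ᴴ * hidx * C⁻¹ := fun hidx hh =>
    (Matrix.isHermitian_conjTranspose_mul_mul C⁻¹ (hh : hidx.IsHermitian)).eq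
  have h₁ind : ∀ hidx : Matrix (Fin 2) (Fin 2) ℂ, hidx.det.re < 0 → ((C⁻¹)ᴴ * hidx * C⁻¹).det.re < 0 := fun hidx hd =>
    det_re_conjTranspose_mul_mul_neg hd hCidet
  have hRherm : ∀ hidx : Matrix (Fin 2) (Fin 2) ℂ, hidxᴴ = hidx → ∀ R : Matrix (Fin 2) (Fin 2) ℂ, Rᴴ = R →
      (Rᴴ * ((C⁻¹)ᴴ * hidx * C⁻¹) * R)ᴴ = Rᴴ * ((C⁻¹)ᴴ * hidx * C⁻¹) * R := fun hidx hh R _ =>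
    (Matrix.isHermitian_conjTranspose_mul_mul R ((h₁herm hidx hh : ((C⁻¹)ᴴ * hidx * C⁻¹).IsHermitian))).eq
  have hRind : ∀ hidx : Matrix (Fin 2) (Fin 2) ℂ, hidx.det.re < 0 → ∀ R : Matrix (Fin 2) (Fin 2) ℂ, IsUnit R.det →
      (Rᴴ * ((C⁻¹)ᴴ * hidx * C⁻¹) * R).det.re < 0 := fun hidx hd R hRu => det_re_conjTranspose_mul_mul_neg (h₁ind hidx hd) hRu.ne_zero
  /- the explicit formula as a function of the index and a Siegel-form decomposition, its holomorphy and its norm -/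
  set Φ : Matrix (Fin 2) (Fin 2) ℂ → Matrix (Fin 2) (Fin 2) ℂ → Matrix (Fin 2) (Fin 2) ℂ → ℂ → ℂ := fun hidx X₀ R s =>
    (1 / 8 : ℂ) * (((((‖C.det‖ : ℝ) : ℂ) ^ 4)⁻¹) * (cexp ((2 * Real.pi * I) * (((C⁻¹)ᴴ * hidx * C⁻¹) * X₀).trace) *
      ((fun z : ℂ => (conj z / ((‖z‖ : ℝ) : ℂ)) ^ k) R⁻¹.det * (((‖R.det‖ : ℝ) : ℂ) ^ (2 - 2 * s) * FJ (Rᴴ * ((C⁻¹)ᴴ * hidx * C⁻¹) * R) s)))) with hΦ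
  have hΦhol : ∀ hidx : Matrix (Fin 2) (Fin 2) ℂ, hidxᴴ = hidx → hidx.det.re < 0 → ∀ X₀ R : Matrix (Fin 2) (Fin 2) ℂ, Rᴴ = R → IsUnit R.det →
      DifferentiableOn ℂ (Φ hidx X₀ R) {s : ℂ | 0 < s.re} := by
    intro hidx hh hd X₀ R hR hRu
    have hRpos : 0 < ‖R.det‖ := norm_pos_iff.2 hRu.ne_zero
    have hcpow : Differentiable ℂ (fun s : ℂ => ((‖R.det‖ : ℝ) : ℂ) ^ (2 - 2 * s)) :=
      Differentiable.const_cpow ((differentiable_const _).sub ((differentiable_const _).mul differentiable_id))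
        (Or.inl (ofReal_ne_zero.2 hRpos.ne'))
    have hF2 : DifferentiableOn ℂ (FJ (Rᴴ * ((C⁻¹)ᴴ * hidx * C⁻¹) * R)) {s : ℂ | 0 < s.re} := hFJhol _ (hRherm hidx hh R hR) (hRind hidx hd R hRu)
    exact (differentiableOn_const _).mul ((differentiableOn_const _).mul ((differentiableOn_const _).mul
      ((differentiableOn_const _).mul (hcpow.differentiableOn.mul hF2))))
  have hΦnorm : ∀ hidx : Matrix (Fin 2) (Fin 2) ℂ, hidxᴴ = hidx → ∀ X₀ R : Matrix (Fin 2) (Fin 2) ℂ, X₀ᴴ = X₀ → Rᴴ = R → IsUnit R.det → ∀ s : ℂ,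
      ‖Φ hidx X₀ R s‖ = 8⁻¹ * (‖C.det‖ ^ 4)⁻¹ * (‖R.det‖ ^ (2 - 2 * s.re) * ‖FJ (R * ((C⁻¹)ᴴ * hidx * C⁻¹) * R) s‖) := by
    intro hidx hh X₀ R hX₀ hR hRu s
    have hRdet : R.det ≠ 0 := hRu.ne_zero
    have hRpos : 0 < ‖R.det‖ := norm_pos_iff.2 hRdet
    have hK₀n : ‖cexp ((2 * Real.pi * I) * (((C⁻¹)ᴴ * hidx * C⁻¹) * X₀).trace)‖ = 1 := norm_cexp_trace_mul_of_isHermitian (h₁herm hidx hh) hX₀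
    have hχn : ‖(conj R⁻¹.det / ((‖R⁻¹.det‖ : ℝ) : ℂ)) ^ k‖ = 1 := by
      have hne : R⁻¹.det ≠ 0 := by
        rw [Matrix.det_nonsing_inv, Ring.inverse_eq_inv']
        exact inv_ne_zero hRdet
      exact norm_archChar_eq_one hne k
    have hpow : ‖(((‖R.det‖ : ℝ) : ℂ) ^ (2 - 2 * s))‖ = ‖R.det‖ ^ (2 - 2 * s.re) := by
      rw [Complex.norm_cpow_eq_rpow_re_of_pos hRpos]
      congr 1; simp [Complex.sub_re, Complex.mul_re]
    simp only [hΦ]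
    rw [hR, norm_mul, norm_mul, norm_mul, norm_mul, norm_mul, hK₀n, hχn, one_mul, one_mul, hpow, norm_inv, norm_pow,
      Complex.norm_real, Real.norm_eq_abs, abs_norm]
    have h8 : ‖(1 / 8 : ℂ)‖ = 8⁻¹ := by norm_num
    rw [h8]; ring
  /- the family -/
  refine ⟨fun hidx g => if hS : ∃ X₀ R : Matrix (Fin 2) (Fin 2) ℂ, X₀ᴴ = X₀ ∧ Rᴴ = R ∧ IsUnit R.det ∧
        (fromBlocks C 0 0 (-B) : Matrix (Fin 2 ⊕ Fin 2) (Fin 2 ⊕ Fin 2) ℂ) * g = fromBlocks 1 X₀ 0 1 * fromBlocks R 0 0 R⁻¹ then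
        Φ hidx hS.choose hS.choose_spec.choose
      else if hg : gᴴ * Matrix.J (Fin 2) ℂ * g = Matrix.J (Fin 2) ℂ ∧ hidxᴴ = hidx ∧ hidx.det.re < 0 then
        Classical.choose (exists_twistedWhittaker_continuation_of_indef_pic hJet k hk Pic B C hx g hg.1 hidx hg.2.1 hg.2.2
          (fun b => cexp (-(2 * Real.pi * I) * (hidx * b).trace)) (fun _ => rfl) hKpic)
      else fun _ => 0, fun hidx hsgn eb heb g hg => ?_, fun z hz => ?_⟩
  · -- holomorphy and the formula for every index and every `g ∈ U(J)`
    obtain ⟨hherm, hind⟩ := hsgn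
    beta_reduce
    by_cases hS : ∃ X₀ R : Matrix (Fin 2) (Fin 2) ℂ, X₀ᴴ = X₀ ∧ Rᴴ = R ∧ IsUnit R.det ∧
        (fromBlocks C 0 0 (-B) : Matrix (Fin 2 ⊕ Fin 2) (Fin 2 ⊕ Fin 2) ℂ) * g = fromBlocks 1 X₀ 0 1 * fromBlocks R 0 0 R⁻¹
    · obtain ⟨hX₀c, hRc, hRcu, hdecc⟩ := hS.choose_spec.choose_spec
      simp only [dif_pos hS]
      refine ⟨hΦhol hidx hherm hind _ _ hRc hRcu, s₀, fun s hs F hF hFQ => ?_⟩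
      rw [hform hidx hherm hind eb heb g hg _ _ hX₀c hRc hRcu hdecc s hs F hF hFQ]
    · have hg' : gᴴ * Matrix.J (Fin 2) ℂ * g = Matrix.J (Fin 2) ℂ ∧ hidxᴴ = hidx ∧ hidx.det.re < 0 := ⟨hg, hherm, hind⟩
      simp only [dif_neg hS, dif_pos hg']
      obtain ⟨s₁, hhol, hEw⟩ := Classical.choose_spec (exists_twistedWhittaker_continuation_of_indef_pic hJet k hk Pic B C hx g hg'.1 hidx hg'.2.1 hg'.2.2
        (fun b => cexp (-(2 * Real.pi * I) * (hidx * b).trace)) (fun _ => rfl) hKpic)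
      refine ⟨hhol, s₁, fun s hs F hF hFQ => ?_⟩
      simp only [heb]
      exact hEw s hs F hF hFQ
  · /- the uniform growth on the ball `dist s z < r` -/
    obtain ⟨Cg, cg, N, N', r, hCg, hcg, hN, hN', hr, hB⟩ := hFJgr z hz
    refine ⟨8⁻¹ * (‖C.det‖ ^ 4)⁻¹ * Cg * 4 ^ N, cg / 4, N, N', r, by positivity, by positivity, hN, hN', hr,
      fun hidx hsgn eb _ g _ X₀ R hX₀ hR hRu hdec s hs => ?_⟩
    obtain ⟨hherm, hind⟩ := hsgn
    beta_reduce
    have hS : ∃ X₀ R : Matrix (Fin 2) (Fin 2) ℂ, X₀ᴴ = X₀ ∧ Rᴴ = R ∧ IsUnit R.det ∧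
        (fromBlocks C 0 0 (-B) : Matrix (Fin 2 ⊕ Fin 2) (Fin 2 ⊕ Fin 2) ℂ) * g = fromBlocks 1 X₀ 0 1 * fromBlocks R 0 0 R⁻¹ := ⟨X₀, R, hX₀, hR, hRu, hdec⟩
    obtain ⟨hX₀c, hRc, hRcu, hdecc⟩ := hS.choose_spec.choose_spec
    simp only [dif_pos hS]
    have h1J : (1 : Matrix (Fin 2 ⊕ Fin 2) (Fin 2 ⊕ Fin 2) ℂ)ᴴ * Matrix.J (Fin 2) ℂ * 1 = Matrix.J (Fin 2) ℂ := by
      rw [conjTranspose_one, Matrix.one_mul, Matrix.mul_one]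
    set h₁ : Matrix (Fin 2) (Fin 2) ℂ := (C⁻¹)ᴴ * hidx * C⁻¹ with hh₁
    set h₂' : Matrix (Fin 2) (Fin 2) ℂ := R * h₁ * R with hh₂'
    have hT' : 0 ≤ ∑ a, ∑ b, ‖h₂' a b‖ := Finset.sum_nonneg fun _ _ => Finset.sum_nonneg fun _ _ => norm_nonneg _
    /- the bound for ANY Siegel-form decomposition `(X₁, R₁)` of `diag(C,−B)·g` — it differs from `(X₀, R)` by a unitary `κ` -/
    have key : ∀ X₁ R₁ : Matrix (Fin 2) (Fin 2) ℂ, X₁ᴴ = X₁ → R₁ᴴ = R₁ → IsUnit R₁.det →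
        (fromBlocks C 0 0 (-B) : Matrix (Fin 2 ⊕ Fin 2) (Fin 2 ⊕ Fin 2) ℂ) * g = fromBlocks 1 X₁ 0 1 * fromBlocks R₁ 0 0 R₁⁻¹ →
        ‖Φ hidx X₁ R₁ s‖ ≤ 8⁻¹ * (‖C.det‖ ^ 4)⁻¹ * Cg * 4 ^ N * ‖R.det‖ ^ (2 - 2 * s.re) * Real.exp (-(cg / 4 * ∑ a, ∑ b, ‖h₂' a b‖)) *
            (1 + ∑ a, ∑ b, ‖h₂' a b‖) ^ N * (1 + ‖h₂'.det‖ ^ (-N')) := by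
      intro X₁ R₁ hX₁ hR₁ hR₁u hdec₁
      rw [hΦnorm hidx hherm X₁ R₁ hX₁ hR₁ hR₁u s, ← hh₁]
      have hcmp : (fromBlocks 1 X₁ 0 1 : Matrix (Fin 2 ⊕ Fin 2) (Fin 2 ⊕ Fin 2) ℂ) * fromBlocks R₁ 0 0 R₁⁻¹ * 1 =
          fromBlocks 1 X₀ 0 1 * fromBlocks R 0 0 R⁻¹ * 1 := by
        rw [Matrix.mul_one, Matrix.mul_one, ← hdec₁, hdec]
      obtain ⟨κ, hκ1, hκ2, hRκ⟩ := levi_letters_unique hRu h1J (moeb_one _) h1J (moeb_one _) hcmp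
      have hRκ' : R₁ = κᴴ * R := by rw [← hR₁, hRκ, conjTranspose_mul, hR]
      set h₂ : Matrix (Fin 2) (Fin 2) ℂ := R₁ * h₁ * R₁ with hh₂
      have hh₂herm : h₂ᴴ = h₂ := by
        have h := hRherm hidx hherm R₁ hR₁
        rw [hR₁] at h
        exact h
      have hh₂ind : h₂.det.re < 0 := by
        have h := hRind hidx hind R₁ hR₁u
        rw [hR₁] at h
        exact h
      have hFJ := hB h₂ hh₂herm hh₂ind s hs
      have hconj : h₂ = κᴴ * h₂' * κ := by
        rw [hh₂, hh₂']
        calc R₁ * h₁ * R₁ = κᴴ * R * h₁ * (R * κ) := by rw [← hRκ', ← hRκ]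
          _ = κᴴ * (R * h₁ * R) * κ := by simp only [Matrix.mul_assoc]
      have hconj' : h₂' = κ * h₂ * κᴴ := by
        rw [hconj]
        calc h₂' = (κ * κᴴ) * h₂' * (κ * κᴴ) := by rw [hκ2, Matrix.one_mul, Matrix.mul_one]
          _ = κ * (κᴴ * h₂' * κ) * κᴴ := by simp only [Matrix.mul_assoc]
      have hdκ : κᴴ.det * κ.det = 1 := by rw [← Matrix.det_mul, hκ1, Matrix.det_one]
      have hnκ : ‖κ.det‖ = 1 := by
        have h := congrArg norm hdκ
        rw [norm_mul, Matrix.det_conjTranspose, norm_star, norm_one] at h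
        nlinarith [norm_nonneg κ.det]
      have hdetR : ‖R₁.det‖ = ‖R.det‖ := by rw [hRκ, Matrix.det_mul, norm_mul, hnκ, mul_one]
      have hdet2 : h₂.det = h₂'.det := by
        rw [hconj, Matrix.det_mul, Matrix.det_mul]
        calc κᴴ.det * h₂'.det * κ.det = h₂'.det * (κᴴ.det * κ.det) := by ring
          _ = h₂'.det := by rw [hdκ, mul_one]
      -- the two-sided entry-sum comparability through the unitary `κ`
      obtain ⟨hκe, hκe'⟩ := unitary_entries_le_one hκ1 hκ2
      have hT1 : ∑ a, ∑ b, ‖h₂' a b‖ ≤ 4 * ∑ a, ∑ b, ‖h₂ a b‖ := by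
        have h := entrySum_mul_mul_le (X := h₂) hκe hκe'
        rw [← hconj'] at h
        linarith
      have hT2 : ∑ a, ∑ b, ‖h₂ a b‖ ≤ 4 * ∑ a, ∑ b, ‖h₂' a b‖ := by
        have h := entrySum_mul_mul_le (X := h₂') hκe' hκe
        rw [← hconj] at h
        linarith
      have hT : 0 ≤ ∑ a, ∑ b, ‖h₂ a b‖ := Finset.sum_nonneg fun _ _ => Finset.sum_nonneg fun _ _ => norm_nonneg _
      have hexp : Real.exp (-(cg * ∑ a, ∑ b, ‖h₂ a b‖)) ≤ Real.exp (-(cg / 4 * ∑ a, ∑ b, ‖h₂' a b‖)) :=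
        exp_neg_mul_le_of_le_mul (by norm_num) hcg.le hT1
      have hpol : (1 + ∑ a, ∑ b, ‖h₂ a b‖) ^ N ≤ 4 ^ N * (1 + ∑ a, ∑ b, ‖h₂' a b‖) ^ N := one_add_rpow_le_of_le_mul (by norm_num) hT hT' hT2 hN
      have hD0 : 0 ≤ 1 + ‖h₂.det‖ ^ (-N') := by positivity
      have hRp : 0 ≤ ‖R.det‖ ^ (2 - 2 * s.re) := Real.rpow_nonneg (norm_nonneg _) _
      rw [hdetR, ← hdet2]
      calc 8⁻¹ * (‖C.det‖ ^ 4)⁻¹ * (‖R.det‖ ^ (2 - 2 * s.re) * ‖FJ h₂ s‖)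
          ≤ 8⁻¹ * (‖C.det‖ ^ 4)⁻¹ * (‖R.det‖ ^ (2 - 2 * s.re) * (Cg * Real.exp (-(cg * ∑ a, ∑ b, ‖h₂ a b‖)) *
              (1 + ∑ a, ∑ b, ‖h₂ a b‖) ^ N * (1 + ‖h₂.det‖ ^ (-N')))) := by
            gcongr
        _ ≤ 8⁻¹ * (‖C.det‖ ^ 4)⁻¹ * (‖R.det‖ ^ (2 - 2 * s.re) * (Cg * Real.exp (-(cg / 4 * ∑ a, ∑ b, ‖h₂' a b‖)) *
              (4 ^ N * (1 + ∑ a, ∑ b, ‖h₂' a b‖) ^ N) * (1 + ‖h₂.det‖ ^ (-N')))) := by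
            gcongr
        _ = 8⁻¹ * (‖C.det‖ ^ 4)⁻¹ * Cg * 4 ^ N * ‖R.det‖ ^ (2 - 2 * s.re) * Real.exp (-(cg / 4 * ∑ a, ∑ b, ‖h₂' a b‖)) *
              (1 + ∑ a, ∑ b, ‖h₂' a b‖) ^ N * (1 + ‖h₂.det‖ ^ (-N')) := by ring
    exact key _ _ hX₀c hRc hRcu hdecc

/-- **THE `evalAt … Q` HEAD** (the architect's (1) `exists_growth_constants_of_indef_at_one`; ★ `K2LiuKindWArchWhittakerGrowthAtOne`'s pattern): the generic head at
the compact picture `Pic s F := ∀ v unitary, F(k_v) = evalAt v hv Q`. [cite: Shimura1997, §16.4, §18.4] [cite: KudlaRallis1994, §1] -/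
theorem exists_growth_constants_of_indef_at_one
    (hJetGrowth : ∀ Θ : Matrix (Fin 2) (Fin 2) ℂ, Θᴴ = Θ → ∀ (e : ℕ) (a b : ℂ),
      ∃ (F : Matrix (Fin 2) (Fin 2) ℂ → ℂ → ℂ) (s₀ : ℝ),
        (∀ h : Matrix (Fin 2) (Fin 2) ℂ, hᴴ = h → h.det.re < 0 → DifferentiableOn ℂ (F h) {s : ℂ | 0 < s.re} ∧
          ∀ s : ℂ, s₀ < s.re → F h s = iteratedDeriv e (fun t : ℝ => xiTwo 1 (h + (t : ℂ) • Θ) (a + s) (b + s)) 0) ∧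
        ∀ z : ℂ, 0 < z.re → ∃ C c Np N' r : ℝ, 0 ≤ C ∧ 0 < c ∧ 0 ≤ Np ∧ 0 ≤ N' ∧ 0 < r ∧
          ∀ h : Matrix (Fin 2) (Fin 2) ℂ, hᴴ = h → h.det.re < 0 → ∀ s : ℂ, dist s z < r →
            ‖F h s‖ ≤ C * Real.exp (-(c * ∑ a, ∑ b, ‖h a b‖)) * (1 + ∑ a, ∑ b, ‖h a b‖) ^ Np * (1 + ‖h.det‖ ^ (-N')))
    {k : ℤ} (hk : -2 ≤ k) (Q : Carrier) {B C : Matrix (Fin 2) (Fin 2) ℂ}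
    (hx : (fromBlocks 0 B C 0 : Matrix (Fin 2 ⊕ Fin 2) (Fin 2 ⊕ Fin 2) ℂ)ᴴ * Matrix.J (Fin 2) ℂ * (fromBlocks 0 B C 0 : Matrix (Fin 2 ⊕ Fin 2) (Fin 2 ⊕ Fin 2) ℂ) =
      Matrix.J (Fin 2) ℂ)
    (hKpic : ∀ k₀ : Matrix (Fin 2 ⊕ Fin 2) (Fin 2 ⊕ Fin 2) ℂ, k₀ᴴ * Matrix.J (Fin 2) ℂ * k₀ = Matrix.J (Fin 2) ℂ →
      moeb k₀ (I • (1 : Matrix (Fin 2) (Fin 2) ℂ)) = I • 1 →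
      ∃ P : MvPolynomial (((Fin 2 ⊕ Fin 2) × (Fin 2 ⊕ Fin 2)) ⊕ ((Fin 2 ⊕ Fin 2) × (Fin 2 ⊕ Fin 2))) ℂ,
        ∀ (s : ℂ) (F : Matrix (Fin 2 ⊕ Fin 2) (Fin 2 ⊕ Fin 2) ℂ → ℂ), IsArchSiegelSection (fun z : ℂ => (conj z / ((‖z‖ : ℝ) : ℂ)) ^ k) s F →
          (∀ (v : Matrix (Fin 2) (Fin 2) ℂ), vᴴ * v = 1 → ∀ hv : v.det ≠ 0,
            F ((2 : ℂ)⁻¹ • fromBlocks (1 + v) (-(I • (1 - v))) (I • (1 - v)) (1 + v) : Matrix (Fin 2 ⊕ Fin 2) (Fin 2 ⊕ Fin 2) ℂ) = evalAt v hv Q) →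
          ∀ u : Matrix (Fin 2 ⊕ Fin 2) (Fin 2 ⊕ Fin 2) ℂ, uᴴ * Matrix.J (Fin 2) ℂ * u = Matrix.J (Fin 2) ℂ → moeb u (I • (1 : Matrix (Fin 2) (Fin 2) ℂ)) = I • 1 →
            F (u * k₀) = MvPolynomial.eval (Sum.elim (fun pq => u pq.1 pq.2) (fun pq => conj (u pq.1 pq.2))) P) :
    ∃ Ew : Matrix (Fin 2) (Fin 2) ℂ → Matrix (Fin 2 ⊕ Fin 2) (Fin 2 ⊕ Fin 2) ℂ → ℂ → ℂ,
      (∀ hidx : Matrix (Fin 2) (Fin 2) ℂ, hidxᴴ = hidx ∧ hidx.det.re < 0 →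
        ∀ eb : Matrix (Fin 2) (Fin 2) ℂ → ℂ, (∀ b, eb b = cexp (-(2 * Real.pi * I) * (hidx * b).trace)) →
        ∀ g : Matrix (Fin 2 ⊕ Fin 2) (Fin 2 ⊕ Fin 2) ℂ, gᴴ * Matrix.J (Fin 2) ℂ * g = Matrix.J (Fin 2) ℂ →
        DifferentiableOn ℂ (Ew hidx g) {s : ℂ | 0 < s.re} ∧
        ∃ s₀ : ℝ, ∀ s : ℂ, s₀ < s.re →
          ∀ F : Matrix (Fin 2 ⊕ Fin 2) (Fin 2 ⊕ Fin 2) ℂ → ℂ, IsArchSiegelSection (fun z : ℂ => (conj z / ((‖z‖ : ℝ) : ℂ)) ^ k) s F →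
            (∀ (v : Matrix (Fin 2) (Fin 2) ℂ), vᴴ * v = 1 → ∀ hv : v.det ≠ 0,
              F ((2 : ℂ)⁻¹ • fromBlocks (1 + v) (-(I • (1 - v))) (I • (1 - v)) (1 + v) : Matrix (Fin 2 ⊕ Fin 2) (Fin 2 ⊕ Fin 2) ℂ) = evalAt v hv Q) →
            ∫ r : Fin 2 → Fin 2 → ℝ, F ((fromBlocks 0 B C 0 : Matrix (Fin 2 ⊕ Fin 2) (Fin 2 ⊕ Fin 2) ℂ) * fromBlocks 1 (hermOfReal r) 0 1 * g) * eb (hermOfReal r) =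
              Ew hidx g s) ∧
      ∀ z : ℂ, 0 < z.re → ∃ Cg cg N N' r : ℝ, 0 ≤ Cg ∧ 0 < cg ∧ 0 ≤ N ∧ 0 ≤ N' ∧ 0 < r ∧
        ∀ hidx : Matrix (Fin 2) (Fin 2) ℂ, hidxᴴ = hidx ∧ hidx.det.re < 0 →
        ∀ eb : Matrix (Fin 2) (Fin 2) ℂ → ℂ, (∀ b, eb b = cexp (-(2 * Real.pi * I) * (hidx * b).trace)) →
        ∀ g : Matrix (Fin 2 ⊕ Fin 2) (Fin 2 ⊕ Fin 2) ℂ, gᴴ * Matrix.J (Fin 2) ℂ * g = Matrix.J (Fin 2) ℂ →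
          ∀ (X₀ R : Matrix (Fin 2) (Fin 2) ℂ), X₀ᴴ = X₀ → Rᴴ = R → IsUnit R.det →
            (fromBlocks C 0 0 (-B) : Matrix (Fin 2 ⊕ Fin 2) (Fin 2 ⊕ Fin 2) ℂ) * g = fromBlocks 1 X₀ 0 1 * fromBlocks R 0 0 R⁻¹ →
            ∀ s : ℂ, dist s z < r →
              ‖Ew hidx g s‖ ≤ Cg * ‖R.det‖ ^ (2 - 2 * s.re) * Real.exp (-(cg * ∑ a, ∑ b, ‖(R * ((C⁻¹)ᴴ * hidx * C⁻¹) * R) a b‖)) *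
                (1 + ∑ a, ∑ b, ‖(R * ((C⁻¹)ᴴ * hidx * C⁻¹) * R) a b‖) ^ N * (1 + ‖(R * ((C⁻¹)ᴴ * hidx * C⁻¹) * R).det‖ ^ (-N')) :=
  exists_growth_constants_of_indef_pic hJetGrowth hk
    (fun (_ : ℂ) (F : Matrix (Fin 2 ⊕ Fin 2) (Fin 2 ⊕ Fin 2) ℂ → ℂ) => ∀ (v : Matrix (Fin 2) (Fin 2) ℂ), vᴴ * v = 1 → ∀ hv : v.det ≠ 0,
      F ((2 : ℂ)⁻¹ • fromBlocks (1 + v) (-(I • (1 - v))) (I • (1 - v)) (1 + v) : Matrix (Fin 2 ⊕ Fin 2) (Fin 2 ⊕ Fin 2) ℂ) = evalAt v hv Q)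
    hx hKpic

end Summit.HodgeConjecture.HodgeConjecture.Cruxes.HLiu418.K2LiuKindWArchWhittakerGrowthIndef

end
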